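import Summits.QuantumFields.BalabanUV.Beta.GAN24.FibreStripOfRows
import Summits.QuantumFields.BalabanUV.Beta.GAN24.ArrowInnerShift
import Summits.QuantumFields.BalabanUV.Beta.GAN24.ArrowAnchorReal
import Summits.QuantumFields.BalabanUV.Beta.GAN24.ArrowOuterShift

/-!
# `BalabanUV.Beta.GAN24.FibreStrip` — binder row G-an2-4 / (CONV-C), road P1-fibre, row **P1-L10** (= node N15, L10(iii)): **(I3′) — THE `j`-UNIFORM STRIP
# REGULARITY OF THE UNIT-NORMALISED STEP-RESOLVENT FIBRE FUNCTION `kFibΔ`**, EXACTLY the shape `ConvCKOfShapes.StripRegularK 3 Lc κ Cst` (TRIGGER-P1 c1)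

NOT IN PRINT; OUR PROOF (cut «(M4) scaled alias-space Neumann, two anchors» = SKELETON-P1 A5 v0.3, owner's file `HOME/b2b-balaban-gan24-formalise-leaf-16/L10-CUT-M4.md`,
ratified by gan24-p1-g2 (journal l.3191), ref2 R17-1).  HONEST FRAMING (cell contract, verbatim): «discharging `BetaPertH` makes Bałaban's UV stability
UNCONDITIONAL — a real constructive-QFT result; it is NOT the continuum limit and NOT the Clay problem.»  HONEST DEPENDENCY (verbatim): «continuum YM on T⁴ ⇐
BetaPertH ∧ nine spine estimates (0/9 proved); BetaPertH ⇐ (D1) ∧ (D4) ∧ CAP+tail; G-an2-4 gates asym, D1 and NE2/3/4.»  WHAT THIS FILE DISCHARGES: the input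
(I3′) (⇒ the wall's uniform-decay binder `hK` via `CombesThomasFibreStep.unitDecayK_of_stripRegular`) of the binder K-slot `ConvCK 3 Lc`; by ITSELF it instantiates NO
wall binder and is NOT «K-slot closed» (that needs (I2′) = row L11 and the assembly L12); NOT BetaPertH, NOT continuum, NOT Clay.  [folklore] assembly, 0 cite.

## Proof = `FibreStripOfRows.fibreStrip_of_rows` (F9a: F1 currency leaf-16, F3 `ArrowAnchorZero` leaf-15-g5, F7 `FibreDetStrip` leaf-09-g6, F8 `StripLegUnits` gan24-p1-g2,
## Y10r `StripRegularPackaging` leaf-06 — all BY NAME) fed with the three analytic rows: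
* F4 `ArrowInnerShift.exists_cIn` (leaf-04-g5): inner Lipschitz on the complex polydisc `|p|∞ ≤ 1/2`, `N`-uniform;
* F5 `ArrowAnchorReal.arrowAnchorReal` (leaf-12-g7): the outer anchor, `‖(outer-scaled arrow matrix at a real q ≠ 0)⁻¹‖ ≤ aR 4`, uniform in `q` and `N`;
* F6 `ArrowOuterShift.outerLipschitz` (leaf-10-g5): outer Lipschitz `cOut·η·(1 + 1/|q|₂)³`, `η ≤ 1`.
-/

noncomputable section

open Matrix Complex
open scoped Matrix.Norms.L2Operator Real BigOperators
open Literature.MathematicalPhysics.QuantumFieldTheory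
open Literature.MathematicalPhysics.QuantumFieldTheory.Balaban1983to89
open Literature.MathematicalPhysics.QuantumFieldTheory.Balaban1983to89.Beta
open Literature.MathematicalPhysics.QuantumFieldTheory.King1986 (momSq)
open B4Strip (Strip reVec ofRealVec)
open B4ContourShift (BZ)
open Summit.QuantumFields.BalabanUV.Beta.GAN24.CombesThomas (sfStep smStep UnitDecayK)
open Summit.QuantumFields.BalabanUV.Beta.GAN24.CombesThomasFibreStep (unitDecayK_of_stripRegular)
open Summit.QuantumFields.BalabanUV.Beta.GAN24.ConvCKOfShapes (StripRegularK)
open Summit.QuantumFields.BalabanUV.Beta.GAN24.ArrowOperator (arrowMat)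
open Summit.QuantumFields.BalabanUV.Beta.GAN24.ArrowScaling (innerArrow outerArrow)
open Summit.QuantumFields.BalabanUV.Beta.GAN24.FibreDetStrip (abs_le_pi_of_mem_BZ)
open Summit.QuantumFields.BalabanUV.Beta.GAN24.FibreDetStripOfAnchors (one_add_inv_sqrt_le)
open Summit.QuantumFields.BalabanUV.Beta.GAN24.FibreStripOfRows (fibreStrip_of_rows)

namespace Summit.QuantumFields.BalabanUV.Beta.GAN24.FibreStrip

variable {Lc : ℕ} [NeZero Lc]

/-- [folklore] `1 ≤ Lc^(j+1)`. -/
theorem one_le_pow_succ (j : ℕ) : 1 ≤ Lc ^ (j + 1) := Nat.one_le_pow _ _ (Nat.pos_of_ne_zero (NeZero.ne Lc))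

/-- [folklore] F6's outer modulus `ω q = (1 + 1/√|q|²)³` (`ArrowOuterShift.outerLipschitz`). -/
def omegaOut (q : Fin 4 → ℝ) : ℝ := (1 + 1 / Real.sqrt (momSq q)) ^ 3

/-- [folklore] Its bound on the outer region `{∃ μ, ρ₀/2 ≤ |q μ|}`: `Ω ρ₀ = (1 + 2/ρ₀)³`. -/
def OmegaOut (ρ₀ : ℝ) : ℝ := (1 + 2 / ρ₀) ^ 3

/-- [folklore] `ω q ≤ Ω ρ₀` on the outer region (`FibreDetStripOfAnchors.one_add_inv_sqrt_le`). -/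
theorem omegaOut_le {ρ₀ : ℝ} (hρ₀ : 0 < ρ₀) (q : Fin 4 → ℝ) (hfar : ∃ μ, ρ₀ / 2 ≤ |q μ|) : omegaOut q ≤ OmegaOut ρ₀ := by
  obtain ⟨μ, hμ⟩ := hfar
  have h := one_add_inv_sqrt_le hρ₀ hμ
  have h0 : 0 ≤ 1 + 1 / Real.sqrt (momSq q) := by positivity
  exact pow_le_pow_left₀ h0 h 3

/-- [folklore] `0 ≤ Ω ρ` for `ρ > 0`. -/
theorem OmegaOut_nonneg (ρ : ℝ) (hρ : 0 < ρ) : 0 ≤ OmegaOut ρ := by unfold OmegaOut; positivity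

/-- [folklore] F6's displayed outer Lipschitz constant at `D = 4` (`ArrowOuterShift.outerLipschitz`). -/
def cOut4 : ℝ :=
  (48 * (4 : ℝ) ^ 2 + 4 * 4) * (π / 2) * (1 + π / 2) ^ 2
    + 2 * Real.sqrt (49 * ((4 : ℝ) + 1) ^ 3 * (1 + Real.sqrt 4 * π / 2) ^ 6 * (64 : ℝ) ^ (4 + 1) * (5 : ℝ) ^ 4)

/-- [folklore] `0 ≤ cOut4`. -/
theorem cOut4_nonneg : 0 ≤ cOut4 := by unfold cOut4; positivity

/-- **(I3′) — ROW P1-L10 (TRIGGER-P1 c1 shape).**  There are `κ > 0` and `Cst` such that for every step `j`, all block offsets `x′ y′` and all fibre indices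
`a b`, `kFibΔ Lc (sfStep Lc) (smStep 3 Lc) j a x′ b y′` is `StripRegular` on `Strip 4 κ` with bound `Cst` — i.e. `ConvCKOfShapes.StripRegularK 3 Lc κ Cst`.
Rows: F4 `ArrowInnerShift.exists_cIn` (leaf-04-g5), F5 `ArrowAnchorReal.arrowAnchorReal` (leaf-12-g7), F6 `ArrowOuterShift.outerLipschitz` (leaf-10-g5), assembled by
`FibreStripOfRows.fibreStrip_of_rows` (F1 leaf-16, F2 leaf-19-g4 + leaf-18, F3 leaf-15-g5, F7 leaf-09-g6, F8 gan24-p1-g2, Y10r leaf-06 — all BY NAME). -/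
theorem fibreStrip : ∃ κ, 0 < κ ∧ ∃ Cst, StripRegularK 3 Lc κ Cst := by
  obtain ⟨cIn, hcIn, hF4⟩ := ArrowInnerShift.exists_cIn 3
  refine fibreStrip_of_rows (Lc := Lc) (aR := ArrowAnchorReal.aR 4) (cIn := cIn) (cOut := cOut4) (ρ₁ := 1 / 2) (η₁ := 1) omegaOut OmegaOut
    (fun j p r hp hr => hF4 (Lc ^ (j + 1)) p r hp hr)
    (fun j q hq hq0 => ArrowAnchorReal.arrowAnchorReal (N := Lc ^ (j + 1)) (one_le_pow_succ j) (abs_le_pi_of_mem_BZ hq) hq0)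
    (fun j q hq hq0 p hpq η hη0 hη1 him => ?_)
    (fun ρ₀ hρ₀ q _ hfar => omegaOut_le hρ₀ q hfar) OmegaOut_nonneg (le_of_lt (ArrowAnchorReal.aR_pos 4)) hcIn cOut4_nonneg
    (by norm_num) one_pos
  have h := ArrowOuterShift.outerLipschitz (D := 4) (N := Lc ^ (j + 1)) (one_le_pow_succ j) q hq hq0 p hpq η hη0 hη1 him
  simpa only [cOut4, omegaOut, Nat.cast_ofNat] using h

/-- **THE WALL'S UNIFORM-DECAY BINDER INPUT from (I3′)**: `∃ κ > 0, ∃ Cst, UnitDecayK 3 Lc (sfStep Lc) (smStep 3 Lc) (Cst·e^{2κ}) (κ/((3+1)·Lc))`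
(`CombesThomasFibreStep.unitDecayK_of_stripRegular`; the `hK`-half of the K-slot — NOT the K-slot, which also needs (I2′) = row L11). -/
theorem unitDecayK_holds : ∃ κ, 0 < κ ∧ ∃ Cst, UnitDecayK 3 Lc (sfStep Lc) (smStep 3 Lc) (Cst * Real.exp (2 * κ)) (κ / ((3 + 1) * Lc)) := by
  obtain ⟨κ, hκ, Cst, h⟩ := fibreStrip (Lc := Lc)
  exact ⟨κ, hκ, Cst, unitDecayK_of_stripRegular _ _ hκ.le h⟩

end Summit.QuantumFields.BalabanUV.Beta.GAN24.FibreStrip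

end
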